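/-
Copyright (c) 2026 the pub-hodgecm-mathlib formalisation cell (harness21).  Prover seat hodgecm-mathlib-K2E1-p03 (g2), Track B ∕ K2-LIT (stream 29),
h413 = `stmt-HodgeConjecture-24833`, line `K2_E1_TraceFormulaBeta`, helper `K2E1InfinitelyManySplitPlaces` (dealer K2E1-plan (g0) BY-NAME DEAL
2026-09-03T22:09:04Z): a CM extension `L/L⁺` — indeed any quadratic extension of number fields — has INFINITELY MANY SPLIT finite places.  2026-09-03.
-/
import Literature.NumberTheory.Automorphic.QuadraticExtensionSplitPlaceExists   -- ★ `QuadraticExtension.exists_smul_ne_under_notMem`, ★ `ramificationIdx_eq_one_and_inertiaDeg_eq_one_of_smul_ne`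
import Literature.NumberTheory.Automorphic.UnitaryGroupSplitPlace                -- ★ `UnitaryGroup.PlacesOver.eq_or_eq_galInv`, ★ `PlacesOver.card_eq_two`, ★ `algEquiv_inv_eq_self`
import Literature.NumberTheory.Automorphic.QuadraticLocalBaseChange               -- ★ instance `UnitaryGroup.PlacesOver.nonempty` (going up)
import Mathlib.NumberTheory.NumberField.CMField                                   -- `IsCMField`, `maximalRealSubfield`, `IsCMField.complexConj`, `complexConj_ne_one`
import HarnessLib

/-!
# h413 ∕ Track B «K2-LIT», line `K2_E1_TraceFormulaBeta`: A CM EXTENSION `L/L⁺` HAS INFINITELY MANY SPLIT FINITE PLACES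
# (helper `K2E1InfinitelyManySplitPlaces`, dealt BY NAME by K2E1-plan (g0) on `K2/STATUS.md` 2026-09-03T22:09:04Z — the auxiliary-place supply of
# Rogawski's (13.8.3), p. 218 «let `u` be a place of `F` which splits in `E` …», and of §14.6, which uses several)

Cell `pub/hodgecm-mathlib`, crux H413 = `stmt-HodgeConjecture-24833`, route `HCCMUnconditional`; chair K2-lead (g0), dealer K2E1-plan (g0).  THEOREMS ONLY (no `def`,
no `instance`, no `notation`, no named-fact hypothesis, no `sorry`); lane `--supports stmt-HodgeConjecture-24833 --as helper` (count-neutral).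

SURVEY ★ FIRST — RESULT: the mathematics is ★ END TO END; this file is the DICTIONARY into the K2·E1 split-place token and the consumer shapes.
* ★ `Literature.NumberTheory.NumberFields.infinite_setOf_prime_absNorm` (`SplitPrimesGaloisClosure`): every number field has infinitely many primes of PRIME
  absolute norm (the tree's kernel-proved Chebotarev theorem, cyclic case, with trivial target; classical Chebotarev-free proofs exist but are not needed);
* ★ `Literature.NumberTheory.Automorphic.finite_setOf_smul_eq_and_inertiaDeg_eq_one` (`FixedDegreeOnePlacesFinite`): for `σ ≠ 1` in `Aut(E/F)` only finitely
  many degree-one places `w` of `E` have `σ • w = w` (they all divide `σ x₀ − x₀ ≠ 0`);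
* ★ `Literature.NumberTheory.Automorphic.QuadraticExtension.exists_smul_ne_under_notMem` (`QuadraticExtensionSplitPlaceExists`): hence for every FINITE set
  `S₁` of finite places of `F` there is a place `w` of `E` with `c • w ≠ w` and `w ∩ 𝓞 F ∉ S₁`;
* ★ `UnitaryGroup.PlacesOver.eq_or_eq_galInv` ∕ `PlacesOver.card_eq_two` (`UnitaryGroupSplitPlace` §1): above `v` lie exactly `w` and `c⁻¹ • w`;
* ★ `ramificationIdx_eq_one_and_inertiaDeg_eq_one_of_smul_ne` (`AdicCompletionDegreeOnePlaceEquiv` §4): `c • w ≠ w ⇒ e(w|v) = f(w|v) = 1`.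

THE TOKEN (row 21 of the TABLE, ★ p854924 `K2E1SplitPlaceTransportDefs`; NOT re-defined — no `IsSplit` predicate is introduced): a finite place
`v : HeightOneSpectrum (𝓞 L⁺)` of `L⁺ = maximalRealSubfield L` SPLITS in the CM field `L` iff `IsCMField.complexConj L • w.1 ≠ w.1` for a (equivalently: every)
place `w : UnitaryGroup.PlacesOver L v` above it.  Everything is first proved for an arbitrary extension of number fields `E/F` with a non-trivial
`F`-automorphism `c` (quadratic where the fibre count is used) and then READ for `F = L⁺`, `E = L`, `c = complexConj L` (Mathlib `IsCMField.complexConj_ne_one`).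

THE STATEMENTS (§4, CM currency; §§1–3 the same over `E/F`).
* **`InfinitelyManySplitPlaces`** · `{v : HeightOneSpectrum (𝓞 L⁺) | ∃ w : PlacesOver L v, complexConj L • w.1 ≠ w.1}.Infinite` — THE DEAL;
* `cm_infinite_setOf_smul_ne` · `{w : HeightOneSpectrum (𝓞 L) | complexConj L • w ≠ w}.Infinite` (places of `L` moved by `c`);
* consumer shapes: `cm_exists_split_notMem` (for every finite `S`, a split `v ∉ S`), `cm_exists_split_notMem_of_eventually` (… satisfying in addition any
  COFINITE condition `Q`, e.g. good reduction of the hermitian form, ★ `eventually_goodReductionAt`), `cm_exists_two_split_notMem` (two distinct split places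
  outside `S`), `cm_exists_finset_split` (`n` of them, any `n`);
* token bookkeeping: `cm_smul_ne_iff_of_placesOver` (the token does not depend on the chosen `w ∣ v`), `cm_exists_smul_ne_iff_forall`,
  `cm_exists_smul_ne_iff_card_eq_two` (split ⟺ exactly two places above `v`), `cm_card_placesOver_eq_one_iff` (non-split ⟺ one place above `v`);
* BRIDGE to the ideal-theoretic token: `cm_smul_ne_iff_ramificationIdx_eq_one_and_inertiaDeg_eq_one` (`c • w ≠ w ⟺ e(w|v) = f(w|v) = 1`, the converse
  by the fundamental identity `#{𝔓 ∣ v}·e·f = [L:L⁺] = 2`, Mathlib `Ideal.ncard_primesOver_mul_ramificationIdxIn_mul_inertiaDegIn`).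

THE MATHEMATICS.  Infinitude is immediate from ★ `exists_smul_ne_under_notMem`: were the set of split `v` (resp. of moved `w`) finite, feed it (resp. its image
under `w ↦ w ∩ 𝓞 F`) to ★ as the excluded set.  Classical sources: [Marcus2018, Ch. 4 Exercise 30 (b)] (Chebotarev-free, à la Schur), [NeukirchANT1999,
Ch. I §9 (9.4); Ch. VII §13 (13.6)], [FrohlichTaylor1990, Ch. III §1 Thm. 20] (`(L:K) = efg`).

HONEST LABEL.  HC_CM is proved only modulo the 7 printed citations (2 remaining named inputs: hLiu418 = `stmt-HodgeConjecture-24832`, h413 =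
`stmt-HodgeConjecture-24833`) until rung 0 closes; this file proves no printed statement of [Rogawski1990] and is count-neutral.

## References
* [Rogawski1990] J. Rogawski, *Automorphic representations of unitary groups in three variables*, Ann. of Math. Stud. 123 (1990), §13.8 p. 218 (proof of
  (13.8.3): «let `u` be a place of `F` which splits in `E`»), §14.6 (auxiliary split places) — context of use only.
* [Marcus2018] D. Marcus, *Number Fields*, 2nd ed. (2018), Ch. 4, Exercise 30 (b) (infinitely many primes of degree one ∕ split primes).
* [NeukirchANT1999] J. Neukirch, *Algebraic Number Theory* (1999), Ch. I §9 (9.4); Ch. VII §13 (13.6).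
* [FrohlichTaylor1990] A. Fröhlich, M. Taylor, *Algebraic Number Theory* (1991), Ch. III §1 Thm. 20.
-/

set_option autoImplicit false
set_option linter.dupNamespace false  -- the mandated namespace repeats the summit's segment (`HodgeConjecture.HodgeConjecture`)

noncomputable section

namespace Summit.HodgeConjecture.HodgeConjecture.Cruxes.H413.K2E1InfinitelyManySplitPlaces

open NumberField IsDedekindDomain Filter Set
open Literature.NumberTheory.Automorphic Literature.NumberTheory.Automorphic.UnitaryGroup

section Quadratic

variable (F : Type) [Field F] [NumberField F] {E : Type} [Field E] [NumberField E] [Algebra F E]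

/-! ## §1 The split-place token `c • w ≠ w` over `v`: independent of `w ∣ v`; split ⟺ two places above `v` -/

/-- `g⁻¹ • x = x ↔ g • x = x` (any group action; used for `c⁻¹ • w` versus `c • w` on places). [folklore] -/
theorem inv_smul_eq_self_iff {G α : Type*} [Group G] [MulAction G α] (g : G) (x : α) : g⁻¹ • x = x ↔ g • x = x := by
  rw [inv_smul_eq_iff, eq_comm]

/-- **The token does not depend on the place above `v`**: for a quadratic extension `E/F`, `c ≠ 1`, and two places `w, w' ∣ v` of `E`,
`c • w ≠ w ↔ c • w' ≠ w'` (the places above `v` are `w` and `c⁻¹ • w`, ★ `PlacesOver.eq_or_eq_galInv`). [cite: CasselsFrohlichANT1967, Ch. VII Prop. 1.2 (ii)] -/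
theorem smul_ne_iff_of_placesOver [Algebra.IsQuadraticExtension F E] {c : E ≃ₐ[F] E} (hc : c ≠ 1)
    {v : HeightOneSpectrum (𝓞 F)} (w w' : PlacesOver E v) : c • w.1 ≠ w.1 ↔ c • w'.1 ≠ w'.1 := by
  rcases PlacesOver.eq_or_eq_galInv c hc w w' with rfl | rfl
  · exact Iff.rfl
  · change c • w.1 ≠ w.1 ↔ c • (c⁻¹ • w.1) ≠ c⁻¹ • w.1
    rw [smul_inv_smul, ne_comm (a := w.1), Ne, Ne, inv_smul_eq_self_iff]

/-- Over `v` SOME place is moved by `c` iff EVERY place is (the fibre is non-empty, ★ `PlacesOver.nonempty`). [folklore] -/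
theorem exists_smul_ne_iff_forall [Algebra.IsQuadraticExtension F E] {c : E ≃ₐ[F] E} (hc : c ≠ 1) (v : HeightOneSpectrum (𝓞 F)) :
    (∃ w : PlacesOver E v, c • w.1 ≠ w.1) ↔ ∀ w : PlacesOver E v, c • w.1 ≠ w.1 := by
  refine ⟨fun ⟨w, hw⟩ w' => (smul_ne_iff_of_placesOver F hc w w').mp hw, fun h => ?_⟩
  obtain ⟨w⟩ := (inferInstance : Nonempty (PlacesOver E v))
  exact ⟨w, h w⟩

/-- **Non-split ⟺ one place above `v`**: if `c • w = w` for a place `w ∣ v` then `w` is the only place of `E` above `v`, and conversely.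
[cite: FrohlichTaylor1990, Ch. III §1 Thm. 20] -/
theorem card_placesOver_eq_one_iff [Algebra.IsQuadraticExtension F E] {c : E ≃ₐ[F] E} (hc : c ≠ 1)
    {v : HeightOneSpectrum (𝓞 F)} (w : PlacesOver E v) : Nat.card (PlacesOver E v) = 1 ↔ c • w.1 = w.1 := by
  constructor
  · intro h1
    by_contra hne
    have h2 := PlacesOver.card_eq_two c hc w hne
    omega
  · intro hw
    rw [Nat.card_eq_one_iff_exists]
    refine ⟨w, fun w' => ?_⟩
    rcases PlacesOver.eq_or_eq_galInv c hc w w' with rfl | h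
    · rfl
    · rw [h]
      exact Subtype.ext ((inv_smul_eq_self_iff c w.1).mpr hw)

/-- **Split ⟺ two places above `v`**: some (every) place `w ∣ v` has `c • w ≠ w` iff `v` has exactly two places of `E` above it
(★ `PlacesOver.card_eq_two` and `card_placesOver_eq_one_iff`). [cite: FrohlichTaylor1990, Ch. III §1 Thm. 20] -/
theorem exists_smul_ne_iff_card_eq_two [Algebra.IsQuadraticExtension F E] {c : E ≃ₐ[F] E} (hc : c ≠ 1) (v : HeightOneSpectrum (𝓞 F)) :
    (∃ w : PlacesOver E v, c • w.1 ≠ w.1) ↔ Nat.card (PlacesOver E v) = 2 := by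
  constructor
  · rintro ⟨w, hw⟩
    exact PlacesOver.card_eq_two c hc w hw
  · intro h2
    obtain ⟨w⟩ := (inferInstance : Nonempty (PlacesOver E v))
    refine ⟨w, fun hw => ?_⟩
    have h1 := (card_placesOver_eq_one_iff F hc w).mpr hw
    omega

/-! ## §2 Bridge to the ideal-theoretic token: `c • w ≠ w ⟺ e(w|v) = f(w|v) = 1` -/

/-- If `c • w = w` (quadratic `E/F`, `c ≠ 1`) then `𝔭_w` is the ONLY prime of `𝓞 E` over `v = w ∩ 𝓞 F` (`Gal(E/F) = {1, c}` is transitive on the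
primes over `v`, ★ `HeightOneSpectrum.exists_algEquiv_smul_eq`). [cite: CasselsFrohlichANT1967, Ch. VII Prop. 1.2 (ii)] -/
theorem primesOver_eq_singleton_of_smul_eq [Algebra.IsQuadraticExtension F E] {c : E ≃ₐ[F] E} (hc : c ≠ 1)
    {w : HeightOneSpectrum (𝓞 E)} (hw : c • w = w) :
    (w.under (𝓞 F)).asIdeal.primesOver (𝓞 E) = {w.asIdeal} := by
  ext Q
  constructor
  · rintro ⟨hQp, hQo⟩
    have hQ0 : Q ≠ ⊥ := Ideal.ne_bot_of_liesOver_of_ne_bot (w.under (𝓞 F)).ne_bot Q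
    set w' : HeightOneSpectrum (𝓞 E) := ⟨Q, hQp, hQ0⟩ with hw'
    have hunder : w.under (𝓞 F) = w'.under (𝓞 F) := HeightOneSpectrum.ext hQo.over
    obtain ⟨σ, hσ⟩ := HeightOneSpectrum.exists_algEquiv_smul_eq F (E := E) hunder
    rcases algEquiv_eq_one_or_eq F hc σ with rfl | rfl
    · rw [one_smul] at hσ
      exact congrArg HeightOneSpectrum.asIdeal hσ.symm
    · rw [hw] at hσ
      exact congrArg HeightOneSpectrum.asIdeal hσ.symm
  · rintro rfl
    exact ⟨w.isPrime, ⟨rfl⟩⟩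

/-- **`c • w ≠ w ⟺ e(w|v) = 1 ∧ f(w|v) = 1`** for a quadratic extension `E/F` and `c ≠ 1` in `Aut(E/F)`: «⇒» is ★
`ramificationIdx_eq_one_and_inertiaDeg_eq_one_of_smul_ne`; «⇐»: if `c • w = w` there is one prime over `v`, so the fundamental identity
`#{𝔓 ∣ v}·e·f = #Aut(E/F) = 2` (Mathlib `Ideal.ncard_primesOver_mul_ramificationIdxIn_mul_inertiaDegIn`) gives `e·f = 2`. [cite: FrohlichTaylor1990, Ch. III §1 Thm. 20] -/
theorem smul_ne_iff_ramificationIdx_eq_one_and_inertiaDeg_eq_one [Algebra.IsQuadraticExtension F E] {c : E ≃ₐ[F] E} (hc : c ≠ 1)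
    (w : HeightOneSpectrum (𝓞 E)) :
    c • w ≠ w ↔ w.asIdeal.ramificationIdx (𝓞 F) = 1 ∧ w.asIdeal.inertiaDeg (𝓞 F) = 1 := by
  refine ⟨fun hw => ramificationIdx_eq_one_and_inertiaDeg_eq_one_of_smul_ne F c hw, fun hef hw => ?_⟩
  set p : Ideal (𝓞 F) := (w.under (𝓞 F)).asIdeal with hp
  haveI : p.IsMaximal := (w.under (𝓞 F)).isMaximal
  haveI : w.asIdeal.LiesOver p := ⟨rfl⟩
  haveI : IsGaloisGroup (E ≃ₐ[F] E) (𝓞 F) (𝓞 E) := IsGaloisGroup.of_isFractionRing _ _ _ F E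
  have hid := Ideal.ncard_primesOver_mul_ramificationIdxIn_mul_inertiaDegIn p (𝓞 E) (E ≃ₐ[F] E)
  have hcard : Nat.card (E ≃ₐ[F] E) = 2 :=
    (Algebra.IsQuadraticExtension.finrank_eq_two F E) ▸ IsGalois.card_aut_eq_finrank F E
  rw [hcard, Ideal.ramificationIdxIn_eq_ramificationIdx p w.asIdeal (E ≃ₐ[F] E),
    Ideal.inertiaDegIn_eq_inertiaDeg p w.asIdeal (E ≃ₐ[F] E), hef.1, hef.2,
    primesOver_eq_singleton_of_smul_eq F hc hw, Set.ncard_singleton] at hid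
  omega

/-! ## §3 Infinitely many split places (any `E/F` with `c ≠ 1`); the consumer shapes -/

/-- **Infinitely many places of `E` are moved by `c`** (`c ≠ 1` in `Aut(E/F)`): were they finitely many, their restrictions to `F` would be a finite set
outside which ★ `exists_smul_ne_under_notMem` still finds one. [cite: Marcus2018, Ch. 4, Exercise 30 (b)] [cite: NeukirchANT1999, Ch. I §9 (9.4)] -/
theorem infinite_setOf_smul_ne {c : E ≃ₐ[F] E} (hc : c ≠ 1) : {w : HeightOneSpectrum (𝓞 E) | c • w ≠ w}.Infinite := by
  intro hfin
  obtain ⟨w, hw, hwS⟩ := QuadraticExtension.exists_smul_ne_under_notMem F E hc (hfin.image fun w => w.under (𝓞 F))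
  exact hwS (Set.mem_image_of_mem _ hw)

/-- **INFINITELY MANY PLACES OF `F` SPLIT IN `E`**: the set of finite places `v` of `F` with a place `w ∣ v` of `E` moved by `c` is infinite
(`c ≠ 1` in `Aut(E/F)`; for `E/F` quadratic these are exactly the split places, §§1–2). [cite: Marcus2018, Ch. 4, Exercise 30 (b)] [cite: NeukirchANT1999, Ch. VII §13 (13.6)] -/
theorem infinite_setOf_exists_smul_ne {c : E ≃ₐ[F] E} (hc : c ≠ 1) :
    {v : HeightOneSpectrum (𝓞 F) | ∃ w : PlacesOver E v, c • w.1 ≠ w.1}.Infinite := by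
  intro hfin
  obtain ⟨w, hw, hwS⟩ := QuadraticExtension.exists_smul_ne_under_notMem F E hc hfin
  exact hwS ⟨⟨w, rfl⟩, hw⟩

/-- Filter form: split places are FREQUENT along the cofinite filter of the finite places of `F`. [folklore] -/
theorem frequently_cofinite_exists_smul_ne {c : E ≃ₐ[F] E} (hc : c ≠ 1) :
    ∃ᶠ v : HeightOneSpectrum (𝓞 F) in cofinite, ∃ w : PlacesOver E v, c • w.1 ≠ w.1 :=
  frequently_cofinite_iff_infinite.mpr (infinite_setOf_exists_smul_ne F hc)

/-- **CONSUMER SHAPE — a split place outside `S` satisfying any cofinite condition**: for `c ≠ 1`, every finite set `S₁` of finite places of `F` and every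
property `Q` holding at all but finitely many places, there is `v ∉ S₁` with `Q v` and a place `w ∣ v` moved by `c`. [cite: Rogawski1990, §13.8 p. 218] -/
theorem exists_split_notMem_of_eventually {c : E ≃ₐ[F] E} (hc : c ≠ 1) {Q : HeightOneSpectrum (𝓞 F) → Prop} (hQ : ∀ᶠ v in cofinite, Q v)
    {S₁ : Set (HeightOneSpectrum (𝓞 F))} (hS₁ : S₁.Finite) :
    ∃ v : HeightOneSpectrum (𝓞 F), v ∉ S₁ ∧ Q v ∧ ∃ w : PlacesOver E v, c • w.1 ≠ w.1 := by
  obtain ⟨v, hv, hvS, hvQ⟩ := ((frequently_cofinite_exists_smul_ne F hc).and_eventually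
    (hS₁.eventually_cofinite_notMem.and hQ)).exists
  exact ⟨v, hvS, hvQ, hv⟩

/-- **CONSUMER SHAPE — a split place outside any finite set** (the form «let `u ∉ S` be a place of `F` which splits in `E`»).
[cite: Rogawski1990, §13.8 p. 218] [cite: NeukirchANT1999, Ch. I §9 (9.4)] -/
theorem exists_split_notMem {c : E ≃ₐ[F] E} (hc : c ≠ 1) {S₁ : Set (HeightOneSpectrum (𝓞 F))} (hS₁ : S₁.Finite) :
    ∃ v : HeightOneSpectrum (𝓞 F), v ∉ S₁ ∧ ∃ w : PlacesOver E v, c • w.1 ≠ w.1 := by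
  obtain ⟨v, hvS, -, hv⟩ := exists_split_notMem_of_eventually F hc (Q := fun _ => True) (Eventually.of_forall fun _ => trivial) hS₁
  exact ⟨v, hvS, hv⟩

/-- **CONSUMER SHAPE — `n` split places outside `S`**: for every `n` there is a set of `n` finite places of `F`, disjoint from the finite set `S₁`, each
split in `E`. [cite: Rogawski1990, §14.6] [cite: Marcus2018, Ch. 4, Exercise 30 (b)] -/
theorem exists_finset_split {c : E ≃ₐ[F] E} (hc : c ≠ 1) {S₁ : Set (HeightOneSpectrum (𝓞 F))} (hS₁ : S₁.Finite) (n : ℕ) :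
    ∃ T : Finset (HeightOneSpectrum (𝓞 F)), T.card = n ∧ ∀ v ∈ T, v ∉ S₁ ∧ ∃ w : PlacesOver E v, c • w.1 ≠ w.1 := by
  obtain ⟨T, hTsub, hTcard⟩ := ((infinite_setOf_exists_smul_ne F hc).sdiff hS₁).exists_subset_card_eq n
  refine ⟨T, hTcard, fun v hv => ?_⟩
  have hv' := hTsub (Finset.mem_coe.mpr hv)
  exact ⟨hv'.2, hv'.1⟩

/-- **CONSUMER SHAPE — two distinct split places outside `S`** (§14.6 uses several auxiliary split places). [cite: Rogawski1990, §14.6] -/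
theorem exists_two_split_notMem {c : E ≃ₐ[F] E} (hc : c ≠ 1) {S₁ : Set (HeightOneSpectrum (𝓞 F))} (hS₁ : S₁.Finite) :
    ∃ v₁ v₂ : HeightOneSpectrum (𝓞 F), v₁ ≠ v₂ ∧ v₁ ∉ S₁ ∧ v₂ ∉ S₁ ∧
      (∃ w : PlacesOver E v₁, c • w.1 ≠ w.1) ∧ (∃ w : PlacesOver E v₂, c • w.1 ≠ w.1) := by
  obtain ⟨v₁, hv₁S, hv₁⟩ := exists_split_notMem F hc hS₁
  obtain ⟨v₂, hv₂S, hv₂⟩ := exists_split_notMem F hc (hS₁.insert v₁)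
  exact ⟨v₁, v₂, fun h => hv₂S (h ▸ Set.mem_insert v₁ S₁), hv₁S, fun h => hv₂S (Set.mem_insert_of_mem v₁ h), hv₁, hv₂⟩

end Quadratic

/-! ## §4 The CM currency: `F = L⁺ = maximalRealSubfield L`, `E = L`, `c = IsCMField.complexConj L` (row 21's token, ★ p854924) -/

section CM

variable (L : Type) [Field L] [NumberField L] [IsCMField L]

/-- **THE DEAL — `InfinitelyManySplitPlaces`: a CM field `L` has infinitely many finite places of `L⁺ = maximalRealSubfield L` that SPLIT in `L`**, in the
K2·E1 token of ★ `K2E1SplitPlaceTransportDefs`: `{v | ∃ w : PlacesOver L v, complexConj L • w.1 ≠ w.1}` is infinite.  The auxiliary-place supply of (13.8.3).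
[cite: Rogawski1990, §13.8 p. 218] [cite: Marcus2018, Ch. 4, Exercise 30 (b)] [cite: NeukirchANT1999, Ch. VII §13 (13.6)] -/
theorem InfinitelyManySplitPlaces :
    {v : HeightOneSpectrum (𝓞 (maximalRealSubfield L)) | ∃ w : PlacesOver L v, IsCMField.complexConj L • w.1 ≠ w.1}.Infinite :=
  infinite_setOf_exists_smul_ne (maximalRealSubfield L) (IsCMField.complexConj_ne_one L)

/-- Infinitely many finite places `w` of the CM field `L` are moved by complex conjugation: `c • w ≠ w`. [cite: Marcus2018, Ch. 4, Exercise 30 (b)] -/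
theorem cm_infinite_setOf_smul_ne : {w : HeightOneSpectrum (𝓞 L) | IsCMField.complexConj L • w ≠ w}.Infinite :=
  infinite_setOf_smul_ne (maximalRealSubfield L) (IsCMField.complexConj_ne_one L)

/-- Filter form of `InfinitelyManySplitPlaces`. [folklore] -/
theorem cm_frequently_cofinite_split :
    ∃ᶠ v : HeightOneSpectrum (𝓞 (maximalRealSubfield L)) in cofinite, ∃ w : PlacesOver L v, IsCMField.complexConj L • w.1 ≠ w.1 :=
  frequently_cofinite_exists_smul_ne (maximalRealSubfield L) (IsCMField.complexConj_ne_one L)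

/-- **CONSUMER SHAPE (CM) — a split place of `L⁺` outside `S` where, in addition, any cofinite condition `Q` holds** (e.g. good reduction of the hermitian
form, ★ `K2E1SplitPlaceTransport.eventually_goodReductionAt`). [cite: Rogawski1990, §13.8 p. 218] -/
theorem cm_exists_split_notMem_of_eventually {Q : HeightOneSpectrum (𝓞 (maximalRealSubfield L)) → Prop} (hQ : ∀ᶠ v in cofinite, Q v)
    {S : Set (HeightOneSpectrum (𝓞 (maximalRealSubfield L)))} (hS : S.Finite) :
    ∃ v : HeightOneSpectrum (𝓞 (maximalRealSubfield L)), v ∉ S ∧ Q v ∧ ∃ w : PlacesOver L v, IsCMField.complexConj L • w.1 ≠ w.1 :=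
  exists_split_notMem_of_eventually (maximalRealSubfield L) (IsCMField.complexConj_ne_one L) hQ hS

/-- **CONSUMER SHAPE (CM) — for every finite set `S` of finite places of `L⁺` there is a split place `v ∉ S`.** [cite: Rogawski1990, §13.8 p. 218] -/
theorem cm_exists_split_notMem {S : Set (HeightOneSpectrum (𝓞 (maximalRealSubfield L)))} (hS : S.Finite) :
    ∃ v : HeightOneSpectrum (𝓞 (maximalRealSubfield L)), v ∉ S ∧ ∃ w : PlacesOver L v, IsCMField.complexConj L • w.1 ≠ w.1 :=
  exists_split_notMem (maximalRealSubfield L) (IsCMField.complexConj_ne_one L) hS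

/-- `Finset` form of `cm_exists_split_notMem`. [cite: Rogawski1990, §13.8 p. 218] -/
theorem cm_exists_split_notMem_finset (S : Finset (HeightOneSpectrum (𝓞 (maximalRealSubfield L)))) :
    ∃ v : HeightOneSpectrum (𝓞 (maximalRealSubfield L)), v ∉ S ∧ ∃ w : PlacesOver L v, IsCMField.complexConj L • w.1 ≠ w.1 := by
  obtain ⟨v, hvS, hv⟩ := cm_exists_split_notMem L S.finite_toSet
  exact ⟨v, fun h => hvS (Finset.mem_coe.mpr h), hv⟩

/-- **CONSUMER SHAPE (CM) — two distinct split places of `L⁺` outside `S`.** [cite: Rogawski1990, §14.6] -/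
theorem cm_exists_two_split_notMem {S : Set (HeightOneSpectrum (𝓞 (maximalRealSubfield L)))} (hS : S.Finite) :
    ∃ v₁ v₂ : HeightOneSpectrum (𝓞 (maximalRealSubfield L)), v₁ ≠ v₂ ∧ v₁ ∉ S ∧ v₂ ∉ S ∧
      (∃ w : PlacesOver L v₁, IsCMField.complexConj L • w.1 ≠ w.1) ∧ (∃ w : PlacesOver L v₂, IsCMField.complexConj L • w.1 ≠ w.1) :=
  exists_two_split_notMem (maximalRealSubfield L) (IsCMField.complexConj_ne_one L) hS

/-- **CONSUMER SHAPE (CM) — `n` split places of `L⁺` outside `S`, any `n`.** [cite: Rogawski1990, §14.6] -/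
theorem cm_exists_finset_split {S : Set (HeightOneSpectrum (𝓞 (maximalRealSubfield L)))} (hS : S.Finite) (n : ℕ) :
    ∃ T : Finset (HeightOneSpectrum (𝓞 (maximalRealSubfield L))), T.card = n ∧
      ∀ v ∈ T, v ∉ S ∧ ∃ w : PlacesOver L v, IsCMField.complexConj L • w.1 ≠ w.1 :=
  exists_finset_split (maximalRealSubfield L) (IsCMField.complexConj_ne_one L) hS n

/-- **TOKEN BOOKKEEPING (CM) — the split token does not depend on the place `w ∣ v` chosen.** [cite: CasselsFrohlichANT1967, Ch. VII Prop. 1.2 (ii)] -/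
theorem cm_smul_ne_iff_of_placesOver {v : HeightOneSpectrum (𝓞 (maximalRealSubfield L))} (w w' : PlacesOver L v) :
    IsCMField.complexConj L • w.1 ≠ w.1 ↔ IsCMField.complexConj L • w'.1 ≠ w'.1 :=
  smul_ne_iff_of_placesOver (maximalRealSubfield L) (IsCMField.complexConj_ne_one L) w w'

/-- (CM) `v` splits at SOME place above it iff at EVERY place above it. [folklore] -/
theorem cm_exists_smul_ne_iff_forall (v : HeightOneSpectrum (𝓞 (maximalRealSubfield L))) :
    (∃ w : PlacesOver L v, IsCMField.complexConj L • w.1 ≠ w.1) ↔ ∀ w : PlacesOver L v, IsCMField.complexConj L • w.1 ≠ w.1 :=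
  exists_smul_ne_iff_forall (maximalRealSubfield L) (IsCMField.complexConj_ne_one L) v

/-- **(CM) split ⟺ exactly two places of `L` above `v`.** [cite: FrohlichTaylor1990, Ch. III §1 Thm. 20] -/
theorem cm_exists_smul_ne_iff_card_eq_two (v : HeightOneSpectrum (𝓞 (maximalRealSubfield L))) :
    (∃ w : PlacesOver L v, IsCMField.complexConj L • w.1 ≠ w.1) ↔ Nat.card (PlacesOver L v) = 2 :=
  exists_smul_ne_iff_card_eq_two (maximalRealSubfield L) (IsCMField.complexConj_ne_one L) v

/-- **(CM) non-split ⟺ exactly one place of `L` above `v`** (`c • w = w` for the place `w ∣ v`). [cite: FrohlichTaylor1990, Ch. III §1 Thm. 20] -/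
theorem cm_card_placesOver_eq_one_iff {v : HeightOneSpectrum (𝓞 (maximalRealSubfield L))} (w : PlacesOver L v) :
    Nat.card (PlacesOver L v) = 1 ↔ IsCMField.complexConj L • w.1 = w.1 :=
  card_placesOver_eq_one_iff (maximalRealSubfield L) (IsCMField.complexConj_ne_one L) w

/-- **BRIDGE (CM) — `c • w ≠ w ⟺ e(w|v) = 1 ∧ f(w|v) = 1`** (`v = w ∩ 𝓞 L⁺`): the row-21 token versus the ideal-theoretic «`v` splits in `L`».
[cite: FrohlichTaylor1990, Ch. III §1 Thm. 20] -/
theorem cm_smul_ne_iff_ramificationIdx_eq_one_and_inertiaDeg_eq_one (w : HeightOneSpectrum (𝓞 L)) :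
    IsCMField.complexConj L • w ≠ w ↔
      w.asIdeal.ramificationIdx (𝓞 (maximalRealSubfield L)) = 1 ∧ w.asIdeal.inertiaDeg (𝓞 (maximalRealSubfield L)) = 1 :=
  smul_ne_iff_ramificationIdx_eq_one_and_inertiaDeg_eq_one (maximalRealSubfield L) (IsCMField.complexConj_ne_one L) w

end CM

end Summit.HodgeConjecture.HodgeConjecture.Cruxes.H413.K2E1InfinitelyManySplitPlaces

end
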